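import Literature.AlgebraicGeometry.AbelianSchemes.AbelianSchemeKOfLClosedSubscheme
import HarnessLib

/-!
# The scheme-theoretic seesaw for an abelian scheme over an AFFINE Noetherian base (F-3 (Mc) node N1′, letter `stub_McN1`)

Layer `Literature/AlgebraicGeometry/AbelianSchemes`, namespace `Literature.AlgebraicGeometry.AbelianSchemes.AbelianSchemeOver`.  THEOREMS
ONLY (no definition, no named fact, no instance, no notation, no `sorry`).  Cell `hodgecm-mathlib` (D-0151 / D-0183 FLOOR 0), programme P1,
sub-line F-3, child (M), grandchild (Mc) node **N1′** (SPINE v0, B-p02 (g16); letter `stub_McN1` of the grandchild skeleton ef3c28a3 ∕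
`STUBMENU-F3Mc-letters.v0` 4c162e6b, stated over an ABSTRACT affine base `S′` with `[IsAffine S′]`).  The unconditional relative seesaw theorem
★ `Motives.SeesawRelative.exists_seesawSubscheme'` ([MumfordAV1970] §10 p. 89; [GortzWedhorn2023] Thm. 24.66; relative edition B-p08 (g11)) is
typed over a base of the form `Spec R`; this file TRANSPORTS it along `e : S′ ≅ Spec Γ(S′, 𝒪)` (Mathlib `Scheme.isoSpec`) to an arbitrary
affine, locally Noetherian base, for the projection `A′ ×_{S′} W → W` of an abelian scheme `A′ → S′`:

* the `Spec`-side family is `A′_B := A′.baseChange e⁻¹` over `B := Spec Γ(S′, 𝒪)` and `W_B := (W → S′ → B)`; the products are compared by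
  the evident map `ψ_T : A′_B ×_B T_B → A′ ×_{S′} T` (§1 `exists_prodComparison_of_baseIso`: its two projections and a SECTION `φ_T`,
  `φ_T ≫ ψ_T = 𝟙`), natural in `T` and compatible with the second projections;
* the seesaw closed subscheme `Z_B ↪ W_B` of `ψ_W^*𝓕` (★, sockets: proper, smooth ⇒ flat + universally open, ★ `geometricallyIntegral_hom_overBase`,
  ★ `univStein_of_isNoetherianRing`) is re-based along `e⁻¹`; factorisations of `u : V → W` through it correspond through `Over.homMk`;
* the module clauses «`(A′ ◁ u)^*𝓕 ≅ pr_V^*𝓜`» on the two sides are compared in `Ȟ¹(A′ ×_{S′} V, 𝒪^×)` (★ `nonempty_iso_iff_detClass_eq`,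
  ★ `detClass_pullback`, ★ `CechPic.pullback_comp`): both `Spec`-side classes are `ψ_V^*` of the `S′`-side classes, and `ψ_V^*` is injective
  because `ψ_V` has a section (★ `CechPic.pullback_id`).

Count-neutral capital: HC_CM is proved only modulo the 7 printed citations until rung 0 closes — nothing here bears on a summit statement.
Cell `hodgecm-mathlib`, (Mc) node N1′: author B-p12 (g18) (road + draft); elaboration (explicit `calc` chains instead of `rw` across the `Over`
carriers, `have`/`obtain` split, opaque `u_B`) F0P1c-p05 (g0).

## References
* [MumfordAV1970] D. Mumford, *Abelian Varieties* (1970), §10 (p. 89).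
* [GortzWedhorn2023] U. Görtz, T. Wedhorn, *Algebraic Geometry II* (2023), Thm. 24.66 (p. 405; proof pp. 407–408), Cor. 24.63 (p. 404).
* [GortzWedhorn2020] U. Görtz, T. Wedhorn, *Algebraic Geometry I* (2nd ed. 2020), Section (4.7) (pp. 107–108) (base change ∕ fibre products).
-/

noncomputable section

-- Mathlib's `Over` monoidal API and `Scheme.Modules` section API are stated across semireducible wrappers.
set_option backward.isDefEq.respectTransparency false

universe u

open CategoryTheory CategoryTheory.Limits AlgebraicGeometry MonoidalCategory CartesianMonoidalCategory
open scoped MonObj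

namespace Literature.AlgebraicGeometry.AbelianSchemes

namespace AbelianSchemeOver

open Literature.AlgebraicGeometry.Motives Literature.AlgebraicGeometry.Modules
  Literature.AlgebraicGeometry.AbelianVarieties

/-! ## §1 The comparison of the products along a base isomorphism -/

/-- **Comparison of the products along a base isomorphism.**  For `e : S′ ≅ B`, an abelian scheme `A′ → S′` and `T → S′`, with
`A′_B := A′.baseChange e⁻¹` and `T_B := (T → S′ → B)`: a morphism `ψ : A′_B ×_B T_B → A′ ×_{S′} T` whose two projections are `pr₁ ≫ (A′_B → A′)`
and `pr₂`, together with a section `φ` (`φ ≫ ψ = 𝟙`).  (All four schemes are fibre products in the sense of Mathlib's chosen `pullback`;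
`(X ⊗ Y).left = pullback X.hom Y.hom` in `Over`.) [cite: GortzWedhorn2020, Section (4.7) (pp. 107–108)] -/
theorem exists_prodComparison_of_baseIso {S' B : Scheme.{u}} (e : S' ≅ B) (A' : AbelianSchemeOver S') (T : Over S') :
    ∃ (ψ : pullback (A'.baseChange e.inv).X.hom (T.hom ≫ e.hom) ⟶ pullback A'.X.hom T.hom)
      (φ : pullback A'.X.hom T.hom ⟶ pullback (A'.baseChange e.inv).X.hom (T.hom ≫ e.hom)),
      ψ ≫ pullback.fst A'.X.hom T.hom =
          pullback.fst (A'.baseChange e.inv).X.hom (T.hom ≫ e.hom) ≫ pullback.fst A'.X.hom e.inv ∧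
        ψ ≫ pullback.snd A'.X.hom T.hom = pullback.snd (A'.baseChange e.inv).X.hom (T.hom ≫ e.hom) ∧ φ ≫ ψ = 𝟙 _ := by
  have h2 : pullback.fst A'.X.hom e.inv ≫ A'.X.hom = (A'.baseChange e.inv).X.hom ≫ e.inv := pullback.condition
  have h1 : pullback.fst (A'.baseChange e.inv).X.hom (T.hom ≫ e.hom) ≫ (A'.baseChange e.inv).X.hom =
      pullback.snd (A'.baseChange e.inv).X.hom (T.hom ≫ e.hom) ≫ (T.hom ≫ e.hom) := pullback.condition
  have hc : (pullback.fst (A'.baseChange e.inv).X.hom (T.hom ≫ e.hom) ≫ pullback.fst A'.X.hom e.inv) ≫ A'.X.hom =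
      pullback.snd (A'.baseChange e.inv).X.hom (T.hom ≫ e.hom) ≫ T.hom :=
    calc (pullback.fst (A'.baseChange e.inv).X.hom (T.hom ≫ e.hom) ≫ pullback.fst A'.X.hom e.inv) ≫ A'.X.hom
        = pullback.fst (A'.baseChange e.inv).X.hom (T.hom ≫ e.hom) ≫ (pullback.fst A'.X.hom e.inv ≫ A'.X.hom) :=
          Category.assoc _ _ _
      _ = pullback.fst (A'.baseChange e.inv).X.hom (T.hom ≫ e.hom) ≫ ((A'.baseChange e.inv).X.hom ≫ e.inv) :=
          congrArg (fun k => pullback.fst (A'.baseChange e.inv).X.hom (T.hom ≫ e.hom) ≫ k) h2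
      _ = (pullback.fst (A'.baseChange e.inv).X.hom (T.hom ≫ e.hom) ≫ (A'.baseChange e.inv).X.hom) ≫ e.inv :=
          (Category.assoc _ _ _).symm
      _ = (pullback.snd (A'.baseChange e.inv).X.hom (T.hom ≫ e.hom) ≫ (T.hom ≫ e.hom)) ≫ e.inv := congrArg (· ≫ e.inv) h1
      _ = pullback.snd (A'.baseChange e.inv).X.hom (T.hom ≫ e.hom) ≫ T.hom := by
          rw [Category.assoc, Category.assoc, e.hom_inv_id, Category.comp_id]
  have hc' : pullback.fst A'.X.hom T.hom ≫ A'.X.hom = (pullback.fst A'.X.hom T.hom ≫ A'.X.hom ≫ e.hom) ≫ e.inv := by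
    rw [Category.assoc, Category.assoc, e.hom_inv_id, Category.comp_id]
  have h3 : pullback.lift (pullback.fst A'.X.hom T.hom) (pullback.fst A'.X.hom T.hom ≫ A'.X.hom ≫ e.hom) hc' ≫
      (A'.baseChange e.inv).X.hom = pullback.fst A'.X.hom T.hom ≫ A'.X.hom ≫ e.hom := pullback.lift_snd _ _ _
  have hc'' : pullback.lift (pullback.fst A'.X.hom T.hom) (pullback.fst A'.X.hom T.hom ≫ A'.X.hom ≫ e.hom) hc' ≫
      (A'.baseChange e.inv).X.hom = pullback.snd A'.X.hom T.hom ≫ (T.hom ≫ e.hom) :=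
    h3.trans (by rw [← Category.assoc, pullback.condition, Category.assoc])
  refine ⟨pullback.lift _ _ hc, pullback.lift _ _ hc'', pullback.lift_fst _ _ _, pullback.lift_snd _ _ _, ?_⟩
  apply pullback.hom_ext
  · calc (pullback.lift _ _ hc'' ≫ pullback.lift _ _ hc) ≫ pullback.fst A'.X.hom T.hom
        = pullback.lift _ _ hc'' ≫ (pullback.lift _ _ hc ≫ pullback.fst A'.X.hom T.hom) := Category.assoc _ _ _
      _ = pullback.lift _ _ hc'' ≫ (pullback.fst (A'.baseChange e.inv).X.hom (T.hom ≫ e.hom) ≫ pullback.fst A'.X.hom e.inv) :=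
          congrArg (fun k => pullback.lift _ _ hc'' ≫ k) (pullback.lift_fst _ _ _)
      _ = (pullback.lift _ _ hc'' ≫ pullback.fst (A'.baseChange e.inv).X.hom (T.hom ≫ e.hom)) ≫ pullback.fst A'.X.hom e.inv :=
          (Category.assoc _ _ _).symm
      _ = pullback.lift (pullback.fst A'.X.hom T.hom) (pullback.fst A'.X.hom T.hom ≫ A'.X.hom ≫ e.hom) hc' ≫
            pullback.fst A'.X.hom e.inv := congrArg (· ≫ pullback.fst A'.X.hom e.inv) (pullback.lift_fst _ _ _)
      _ = pullback.fst A'.X.hom T.hom := pullback.lift_fst _ _ _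
      _ = 𝟙 _ ≫ pullback.fst A'.X.hom T.hom := (Category.id_comp _).symm
  · calc (pullback.lift _ _ hc'' ≫ pullback.lift _ _ hc) ≫ pullback.snd A'.X.hom T.hom
        = pullback.lift _ _ hc'' ≫ (pullback.lift _ _ hc ≫ pullback.snd A'.X.hom T.hom) := Category.assoc _ _ _
      _ = pullback.lift _ _ hc'' ≫ pullback.snd (A'.baseChange e.inv).X.hom (T.hom ≫ e.hom) :=
          congrArg (fun k => pullback.lift _ _ hc'' ≫ k) (pullback.lift_snd _ _ _)
      _ = pullback.snd A'.X.hom T.hom := pullback.lift_snd _ _ _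
      _ = 𝟙 _ ≫ pullback.snd A'.X.hom T.hom := (Category.id_comp _).symm

/-! ## §2 The seesaw closed subscheme over an affine base -/

/-- **THE SCHEME-THEORETIC SEESAW FOR AN ABELIAN SCHEME OVER AN AFFINE BASE** ([GortzWedhorn2023] Thm. 24.66 ∕ [MumfordAV1970] §10, for
`A′ ×_{S′} W → W`, `S′` affine and locally Noetherian — the letter `stub_McN1` of the (Mc) grandchild line): for `W → S′` locally of finite
type and `𝓕` of rank one on `A′ ×_{S′} W` there is a closed subscheme `Z ↪ W` such that an `S′`-morphism `u : V → W` factors through `Z`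
iff `(A′ ◁ u)^*𝓕 ≅ pr_V^*𝓜` for some rank-one `𝓜` on `V`.  See the module docstring for the transport.
[cite: GortzWedhorn2023, Thm. 24.66 (p. 405; proof pp. 407–408)] [cite: MumfordAV1970, §10 (p. 89)] -/
theorem exists_seesawSubscheme_of_isAffine {S' : Scheme.{0}} [IsAffine S'] [IsLocallyNoetherian S'] (A' : AbelianSchemeOver S')
    (W : Over S') [LocallyOfFiniteType W.hom] (𝓕 : (A'.X ⊗ W).left.Modules) (h𝓕 : HasRank 𝓕 1) :
    ∃ (Z : Over S') (i : Z ⟶ W) (_ : IsClosedImmersion i.left),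
      ∀ (V : Over S') (u : V ⟶ W),
        (∃ v : V ⟶ Z, v ≫ i = u) ↔
          ∃ (𝓜 : V.left.Modules) (_ : HasRank 𝓜 1),
            Nonempty ((Scheme.Modules.pullback (A'.X ◁ u).left).obj 𝓕 ≅
              (Scheme.Modules.pullback (CartesianMonoidalCategory.snd A'.X V).left).obj 𝓜) := by
  haveI : IsNoetherianRing Γ(S', ⊤) := IsLocallyNoetherian.component_noetherian ⟨⊤, isAffineOpen_top S'⟩
  -- the `Spec`-side data (`have` + `obtain`: `obtain` on an application generalises the term and times out on these carriers)
  have e : S' ≅ Spec Γ(S', ⊤) := S'.isoSpec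
  have hcmpW := exists_prodComparison_of_baseIso e A' W
  obtain ⟨ψW, φW, hψW₁, hψW₂, -⟩ := hcmpW
  haveI : LocallyOfFiniteType (Over.mk (W.hom ≫ e.hom) : Over (Spec Γ(S', ⊤))).hom := by
    change LocallyOfFiniteType (W.hom ≫ e.hom); infer_instance
  haveI : IsProper (A'.baseChange e.inv).X.hom := (A'.baseChange e.inv).isProper
  haveI : Smooth (A'.baseChange e.inv).X.hom := (A'.baseChange e.inv).isSmooth
  haveI : GeometricallyIntegral (A'.baseChange e.inv).X.hom := (A'.baseChange e.inv).geometricallyIntegral_hom_overBase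
  haveI : Flat (A'.baseChange e.inv).X.hom := inferInstance
  haveI : LocallyOfFinitePresentation (A'.baseChange e.inv).X.hom := inferInstance
  haveI : UniversallyOpen (A'.baseChange e.inv).X.hom := inferInstance
  have h𝓕f := HasRank.isFiniteLocallyFree' h𝓕
  -- the seesaw subscheme of `ψ_W^*𝓕` over `Spec Γ(S′, 𝒪)`
  have hsee := SeesawRelative.exists_seesawSubscheme' (A'.baseChange e.inv).X
    (A'.baseChange e.inv).univStein_of_isNoetherianRing (Over.mk (W.hom ≫ e.hom))
    ((Scheme.Modules.pullback ψW).obj 𝓕) (hasRank_pullback ψW h𝓕)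
  obtain ⟨Z'', i'', hi'', hUP⟩ := hsee
  -- re-base the closed subscheme along `e⁻¹`
  have hiW : i''.left ≫ W.hom = Z''.hom ≫ e.inv := by
    have h : i''.left ≫ (W.hom ≫ e.hom) = Z''.hom := Over.w i''
    rw [← cancel_mono e.hom, Category.assoc, h, Category.assoc, e.inv_hom_id, Category.comp_id]
  refine ⟨Over.mk (Z''.hom ≫ e.inv), Over.homMk i''.left hiW, hi'', fun V u => ?_⟩
  have hcmpV := exists_prodComparison_of_baseIso e A' V
  obtain ⟨ψV, φV, hψV₁, hψV₂, hφψV⟩ := hcmpV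
  have hu : u.left ≫ (W.hom ≫ e.hom) = V.hom ≫ e.hom := by rw [← Category.assoc, Over.w u]
  -- `u` read over `Spec Γ(S′, 𝒪)` (an opaque name with its one property, to keep unification syntactic)
  have huB₀ : ∃ uB : (Over.mk (V.hom ≫ e.hom) : Over (Spec Γ(S', ⊤))) ⟶ Over.mk (W.hom ≫ e.hom), uB.left = u.left :=
    ⟨Over.homMk u.left hu, rfl⟩
  obtain ⟨uB, huB⟩ := huB₀
  -- naturality of `ψ`: `ψ_V ≫ (A′ ◁ u) = (A′_B ◁ u_B) ≫ ψ_W`, and `ψ_V ≫ pr_V = pr_{V_B}` (explicit chains, no `rw` across the carriers)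
  have hnat : ψV ≫ (A'.X ◁ u).left = ((A'.baseChange e.inv).X ◁ uB).left ≫ ψW := by
    apply pullback.hom_ext
    · calc (ψV ≫ (A'.X ◁ u).left) ≫ pullback.fst A'.X.hom W.hom = ψV ≫ ((A'.X ◁ u).left ≫ pullback.fst A'.X.hom W.hom) :=
            Category.assoc _ _ _
        _ = ψV ≫ pullback.fst A'.X.hom V.hom := congrArg (fun k => ψV ≫ k) (Over.whiskerLeft_left_fst (R := A'.X) u)
        _ = pullback.fst (A'.baseChange e.inv).X.hom (V.hom ≫ e.hom) ≫ pullback.fst A'.X.hom e.inv := hψV₁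
        _ = (((A'.baseChange e.inv).X ◁ uB).left ≫ pullback.fst (A'.baseChange e.inv).X.hom (W.hom ≫ e.hom)) ≫
              pullback.fst A'.X.hom e.inv :=
            congrArg (fun k => k ≫ pullback.fst A'.X.hom e.inv) (Over.whiskerLeft_left_fst (R := (A'.baseChange e.inv).X) uB).symm
        _ = ((A'.baseChange e.inv).X ◁ uB).left ≫ (pullback.fst (A'.baseChange e.inv).X.hom (W.hom ≫ e.hom) ≫
              pullback.fst A'.X.hom e.inv) := Category.assoc _ _ _
        _ = ((A'.baseChange e.inv).X ◁ uB).left ≫ (ψW ≫ pullback.fst A'.X.hom W.hom) :=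
            congrArg (fun k => ((A'.baseChange e.inv).X ◁ uB).left ≫ k) hψW₁.symm
        _ = (((A'.baseChange e.inv).X ◁ uB).left ≫ ψW) ≫ pullback.fst A'.X.hom W.hom := (Category.assoc _ _ _).symm
    · calc (ψV ≫ (A'.X ◁ u).left) ≫ pullback.snd A'.X.hom W.hom = ψV ≫ ((A'.X ◁ u).left ≫ pullback.snd A'.X.hom W.hom) :=
            Category.assoc _ _ _
        _ = ψV ≫ (pullback.snd A'.X.hom V.hom ≫ u.left) := congrArg (fun k => ψV ≫ k) (Over.whiskerLeft_left_snd (R := A'.X) u)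
        _ = (ψV ≫ pullback.snd A'.X.hom V.hom) ≫ u.left := (Category.assoc _ _ _).symm
        _ = pullback.snd (A'.baseChange e.inv).X.hom (V.hom ≫ e.hom) ≫ u.left := congrArg (fun k => k ≫ u.left) hψV₂
        _ = pullback.snd (A'.baseChange e.inv).X.hom (V.hom ≫ e.hom) ≫ uB.left := by rw [huB]
        _ = ((A'.baseChange e.inv).X ◁ uB).left ≫ pullback.snd (A'.baseChange e.inv).X.hom (W.hom ≫ e.hom) :=
            (Over.whiskerLeft_left_snd (R := (A'.baseChange e.inv).X) uB).symm
        _ = ((A'.baseChange e.inv).X ◁ uB).left ≫ (ψW ≫ pullback.snd A'.X.hom W.hom) :=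
            congrArg (fun k => ((A'.baseChange e.inv).X ◁ uB).left ≫ k) hψW₂.symm
        _ = (((A'.baseChange e.inv).X ◁ uB).left ≫ ψW) ≫ pullback.snd A'.X.hom W.hom := (Category.assoc _ _ _).symm
  have hsnd : (CartesianMonoidalCategory.snd (A'.baseChange e.inv).X (Over.mk (V.hom ≫ e.hom))).left =
      ψV ≫ (CartesianMonoidalCategory.snd A'.X V).left := hψV₂.symm
  -- `ψ_V^*` is injective on `Ȟ¹(A′ ×_{S′} V, 𝒪^×)` (section `φ_V`)
  have hinj : ∀ a b : CechPic (pullback A'.X.hom V.hom), CechPic.pullback ψV a = CechPic.pullback ψV b → a = b := by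
    intro a b h
    have h' := congrArg (CechPic.pullback φV) h
    rw [← CechPic.pullback_comp, ← CechPic.pullback_comp, hφψV, CechPic.pullback_id, CechPic.pullback_id] at h'
    exact h'
  refine Iff.trans ?_ ((hUP (Over.mk (V.hom ≫ e.hom)) uB).trans ?_)
  · -- factorisations through `Z` vs through `Z''`
    constructor
    · rintro ⟨v, hv⟩
      have hvw : v.left ≫ Z''.hom = V.hom ≫ e.hom := by
        have h : v.left ≫ (Z''.hom ≫ e.inv) = V.hom := Over.w v
        rw [← h, Category.assoc, Category.assoc, e.inv_hom_id, Category.comp_id]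
      -- `(homMk v.left ≫ i'').left = v.left ≫ i''.left = (v ≫ homMk i''.left).left = u.left = uB.left`, definitionally at the ends
      exact ⟨Over.homMk v.left hvw, Over.OverMorphism.ext
        (((congrArg CommaMorphism.left hv).trans huB.symm : (v ≫ Over.homMk i''.left hiW).left = uB.left))⟩
    · rintro ⟨v, hv⟩
      have hvw : v.left ≫ (Z''.hom ≫ e.inv) = V.hom := by
        have h : v.left ≫ Z''.hom = V.hom ≫ e.hom := Over.w v
        rw [← Category.assoc, h, Category.assoc, e.hom_inv_id, Category.comp_id]
      exact ⟨Over.homMk v.left hvw, Over.OverMorphism.ext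
        (((congrArg CommaMorphism.left hv).trans huB : (v ≫ i'').left = u.left))⟩
  · -- module clauses, compared in `Ȟ¹(A′ ×_{S′} V, 𝒪^×)`
    refine exists_congr fun 𝓜 => exists_congr fun h𝓜 => ?_
    have h𝓜f := HasRank.isFiniteLocallyFree' h𝓜
    -- the `S′`-side classes
    have hX : IsFiniteLocallyFree ((Scheme.Modules.pullback (A'.X ◁ u).left).obj 𝓕) := h𝓕f.pullback _
    have hY : IsFiniteLocallyFree ((Scheme.Modules.pullback (CartesianMonoidalCategory.snd A'.X V).left).obj 𝓜) := h𝓜f.pullback _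
    -- the `Spec`-side classes are `ψ_V^*` of them
    have hX'' : IsFiniteLocallyFree ((Scheme.Modules.pullback ((A'.baseChange e.inv).X ◁ uB).left).obj
        ((Scheme.Modules.pullback ψW).obj 𝓕)) := (h𝓕f.pullback ψW).pullback _
    have hY'' : IsFiniteLocallyFree ((Scheme.Modules.pullback
        (CartesianMonoidalCategory.snd (A'.baseChange e.inv).X (Over.mk (V.hom ≫ e.hom))).left).obj 𝓜) := h𝓜f.pullback _
    have cX : detClass hX'' = CechPic.pullback ψV (detClass hX) :=
      calc detClass hX'' = CechPic.pullback _ (detClass (h𝓕f.pullback ψW)) := detClass_pullback _ _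
        _ = CechPic.pullback _ (CechPic.pullback ψW (detClass h𝓕f)) := congrArg _ (detClass_pullback _ _)
        _ = CechPic.pullback (((A'.baseChange e.inv).X ◁ uB).left ≫ ψW) (detClass h𝓕f) := (CechPic.pullback_comp _ _ _).symm
        _ = CechPic.pullback (ψV ≫ (A'.X ◁ u).left) (detClass h𝓕f) :=
            congrArg (fun k => CechPic.pullback k (detClass h𝓕f)) hnat.symm
        _ = CechPic.pullback ψV (CechPic.pullback (A'.X ◁ u).left (detClass h𝓕f)) := CechPic.pullback_comp _ _ _
        _ = CechPic.pullback ψV (detClass hX) := congrArg _ (detClass_pullback _ _).symm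
    have cY : detClass hY'' = CechPic.pullback ψV (detClass hY) :=
      calc detClass hY'' = CechPic.pullback _ (detClass h𝓜f) := detClass_pullback _ _
        _ = CechPic.pullback (ψV ≫ (CartesianMonoidalCategory.snd A'.X V).left) (detClass h𝓜f) :=
            congrArg (fun k => CechPic.pullback k (detClass h𝓜f)) hsnd
        _ = CechPic.pullback ψV (CechPic.pullback (CartesianMonoidalCategory.snd A'.X V).left (detClass h𝓜f)) :=
            CechPic.pullback_comp _ _ _
        _ = CechPic.pullback ψV (detClass hY) := congrArg _ (detClass_pullback _ _).symm
    refine (nonempty_iso_iff_detClass_eq (hasRank_pullback _ (hasRank_pullback ψW h𝓕)) (hasRank_pullback _ h𝓜) hX'' hY'').trans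
      (Iff.trans ?_ (nonempty_iso_iff_detClass_eq (hasRank_pullback _ h𝓕) (hasRank_pullback _ h𝓜) hX hY).symm)
    rw [cX, cY]
    exact ⟨fun h => hinj _ _ h, fun h => congrArg _ h⟩

end AbelianSchemeOver

end Literature.AlgebraicGeometry.AbelianSchemes

end
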